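import Literature.Probability.Distributions.IndepProductLawDistance
import Mathlib.Probability.Distributions.Uniform
import Mathlib.Dynamics.FixedPoints.Basic
import Mathlib.Logic.Equiv.Defs
import HarnessLib

/-!
# The gluing RDE: Langlands' law-level renormalisation `Θ_𝔛` of a finite model of percolation,
# in recursive-distributional-equation form

Topic `Probability/Percolation`; definition request `defn-GluingRDE` (route `CardyGluingRDE` of the
sub-problem `CardyFormulaZ2`, summit `CriticalPhenomena`).

**The printed notion.** Langlands–Pouliot–Saint-Aubin (Bull. AMS 30 (1994), §2.3; after Langlands
1993 and Langlands–Lafortune 1994) attach to a square whose sides are divided into `l` intervals the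
finite STATE SPACE `A` of a *finite model* ("which pairs of boundary intervals are connected") and
a GLUING RULE `Θ_A : A × A × A × A → A` (juxtapose four states into a square with `2l` subdivisions,
compose the paths through coincident interior intervals, fuse the boundary intervals in pairs), and
then pass to laws: "If `𝔛` is the set of measures on `A`, `Θ_A` can be used to define a map
`Θ_𝔛 : 𝔛 → 𝔛`. Since `𝔛` is a simplex in a finite-dimensional space, the question of finding fixed
points of `Θ_𝔛` and studying their nature is well-posed."  `Θ_𝔛 μ` is the law of
`Θ_A (X₀, X₁, X₂, X₃)` for `X₀, …, X₃` independent of law `μ`, i.e. the push-forward of `μ^{⊗4}`.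
The route's planarity-corrected rule decides primal/dual conflicts by fresh independent fair
coins `ξ`, so it is a rule `glue : A⁴ × Ξ → A` driven by an independent INNOVATION `ξ ∼ θ`; the
law-level map is then literally the map `T : 𝒫(S) → 𝒫(S)`, `T(μ) = dist g(ξ; X₁, …, X_N)`
(`Xⱼ` i.i.d. `μ`, independent of `ξ`) induced by a recursive distributional equation
`X =ᵈ g(ξ; X₁, …, X_N)` in the sense of Aldous–Bandyopadhyay (Ann. Appl. Probab. 15 (2005), §1 and
§2.1; here the arity `N ≡ n` is deterministic and `S = A` is finite), whose solutions are the fixed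
points `T(μ) = μ` (restated with these formulas in Bandyopadhyay, Z. Anal. Anwend. 30 (2011)
237–251, eqs. (1)–(2)).

**What is here.** Everything is generic in the finite-or-not state space `S`, the arity `n`
(`n = 4` for the `2 × 2` gluing of the sources, `n = 9` for a `3 × 3` gluing), the innovation space
`Ξ` and its law `θ : PMF Ξ`. The route instantiates `S := BoxArcState k`, `n := 4`,
`glue := PlanarCoinGlue k` and `θ :=` the uniform law on its coin strings (definition items
`defn-BoxArcState`, `defn-PlanarCoinGlue`, not in this file): its `Ψ_k` is
`gluingRDE (PlanarCoinGlue k) (PMF.uniformOfFintype _)`.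

* `gluingRDE glue θ : PMF S → PMF S` — `μ ↦` law of `glue (X₀, …, X_{n-1}) ξ` with `Xᵢ` i.i.d. `μ`
  and `ξ ∼ θ` independent; defined monadically from the tree's product law
  `Literature.Probability.Distributions.indepLaw n (fun _ => μ) = μ^{⊗n}`.
* `gluingRDE_apply`, `gluingRDE_apply_eq_sum`, `toReal_gluingRDE_apply` — the explicit formula
  `(Ψ μ)(s) = ∑_{x : Fin n → S} ∑_ξ θ(ξ) · (∏ᵢ μ(xᵢ)) · [glue x ξ = s]`: a polynomial map of degree
  `n` in the coordinates of `μ` on the simplex; with uniform coin strings `θ(ξ) = 2^{-#coins}`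
  (`gluingRDE_uniformCoins_apply`).
* `langlandsTheta Θ` — the raw, coin-free map `Θ_𝔛 = (μ^{⊗n}).map Θ` of a DETERMINISTIC rule
  `Θ : Sⁿ → S` (LPSA94 verbatim); `gluingRDE_const` (a rule ignoring its innovation gives `Θ_𝔛`) and
  `gluingRDE_eq_bind_langlandsTheta` (the coin-resolved map is the `θ`-mixture of the raw maps of
  the deterministic rules `glue (·) ξ`).
* Symmetric sectors: `symmetricSector γ` — the laws invariant under every member of a family of
  symmetries `γ g : S ≃ S` (for the route: the dihedral group `D₄` of the square and the duality
  involution of `BoxArcState k`); `IsGlueSymmetry glue θ g` — the rule intertwines `g` up to a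
  permutation of the `n` slots and a `θ`-preserving relabelling of the innovations (for uniform
  coins every relabelling qualifies, `IsGlueSymmetry.of_uniform`); `gluingRDE_map_equiv`,
  `mapsTo_gluingRDE_symmetricSector`, `iterate_gluingRDE_mem_symmetricSector` — **`Ψ` maps the
  symmetric sector to itself**, and so do its iterates `(gluingRDE glue θ)^[m]` (Mathlib's
  `Nat.iterate`).
* `tvDist_gluingRDE_le` — the trivial Lipschitz bound **`Δ(Ψ μ, Ψ ν) ≤ n · Δ(μ, ν)`** in the tree's
  total-variation distance `PMF.tvDist` (kernel contraction + the hybrid bound for `μ^{⊗n}`): the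
  "volume factor" `n = 2²` that a contraction statement in the symmetric sector has to beat; the
  iterate `tvDist_iterate_gluingRDE_le` (`≤ n^m Δ`). In particular `Ψ` is Lipschitz-continuous
  for `Δ`.
* Fixed points are Mathlib's `Function.IsFixedPt (gluingRDE glue θ) μ`; `isFixedPt_gluingRDE_iff`
  spells the RDE `μ = T(μ)` out as the system of polynomial equations on the simplex.

## References

* R. Langlands, P. Pouliot, Y. Saint-Aubin, *Conformal invariance in two-dimensional percolation*,
  Bull. Amer. Math. Soc. 30 (1994) 1–61, §2.3 (finite models `A`, `Θ_A : A⁴ → A`, the induced map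
  `Θ_𝔛` on the simplex of measures and its fixed points) [LanglandsPouliotSaintaubin1994].
* R. P. Langlands, M.-A. Lafortune, *Finite models for percolation*, Contemp. Math. 177 (1994)
  227–246 (the finite models) [LanglandsLafortune1994].
* D. J. Aldous, A. Bandyopadhyay, *A survey of max-type recursive distributional equations*,
  Ann. Appl. Probab. 15 (2005) 1047–1110, §1–§2.1 (RDE `X =ᵈ g(ξ; Xⱼ)`, the induced map `T` on
  `𝒫(S)`, fixed points) [AldousBandyopadhyay2005].

## Design and what is NOT here

* Laws are Mathlib `PMF`s (the request's first option); real coordinates enter through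
  `ENNReal.toReal` (`toReal_gluingRDE_apply`, `PMF.tvDist`). No topology or metric-space instance
  is put on `PMF S` (none in Mathlib at the pin); continuity is recorded as the Lipschitz bound.
* Reused, not restated: `indepLaw`/`indepLaw_apply`/`tvDist_indepLaw_le`
  (`Probability/Distributions`), `PMF.tvDist` and `PMF.tvDist_bind_left_le`.
* Not here: the concrete state space and planar coin-resolved rule (`defn-BoxArcState`,
  `defn-PlanarCoinGlue`), the multiresolution metric (`defn-MultiResTV`), existence of fixed points
  (Brouwer on the simplex; not in Mathlib at the pin) and every contraction / stability claim
  (route items of `CardyGluingRDE`): nothing about percolation is asserted in this file.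
-/

noncomputable section

open scoped ENNReal

namespace Literature.Probability.Percolation

open Literature.Probability.Distributions

variable {S Ξ : Type*} {n : ℕ}

/-! ### Helpers: push-forwards along bijections, slot symmetries of `n`-tuples -/

namespace GluingRDE

/-- Push-forward of a `PMF` along a bijection, pointwise: `(p.map F)(b) = p (F⁻¹ b)`. [folklore] -/
theorem pmf_map_equiv_apply {α β : Type*} (p : PMF α) (F : α ≃ β) (b : β) :
    p.map F b = p (F.symm b) := by
  rw [PMF.map_apply]
  refine (tsum_eq_single (F.symm b) fun a ha => if_neg fun h => ha ?_).trans
    (if_pos (F.apply_symm_apply b).symm)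
  rw [h, Equiv.symm_apply_apply]

/-- A bijection of a finite type preserves its uniform law. [folklore] -/
theorem uniformOfFintype_map_equiv_self [Fintype Ξ] [Nonempty Ξ] (e : Ξ ≃ Ξ) :
    (PMF.uniformOfFintype Ξ).map e = PMF.uniformOfFintype Ξ := by
  ext ξ
  rw [pmf_map_equiv_apply, PMF.uniformOfFintype_apply, PMF.uniformOfFintype_apply]

/-- The symmetry of `n`-tuples of states "act by `g` in every slot and permute the slots by `π`":
`x ↦ (i ↦ g (x (π i)))`, as an equivalence of `Fin n → S`. [folklore] -/
def slotEquiv (g : S ≃ S) (π : Equiv.Perm (Fin n)) : (Fin n → S) ≃ (Fin n → S) where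
  toFun x i := g (x (π i))
  invFun y j := g.symm (y (π.symm j))
  left_inv x := funext fun j => by simp
  right_inv y := funext fun i => by simp

/-- `slotEquiv g π x i = g (x (π i))`. [folklore] -/
@[simp] theorem slotEquiv_apply (g : S ≃ S) (π : Equiv.Perm (Fin n)) (x : Fin n → S) (i : Fin n) :
    slotEquiv g π x i = g (x (π i)) := rfl

/-- `(slotEquiv g π)⁻¹ y j = g⁻¹ (y (π⁻¹ j))`. [folklore] -/
@[simp] theorem slotEquiv_symm_apply (g : S ≃ S) (π : Equiv.Perm (Fin n)) (y : Fin n → S)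
    (j : Fin n) : (slotEquiv g π).symm y j = g.symm (y (π.symm j)) := rfl

/-- **An i.i.d. law with `g`-invariant marginal is invariant under the slot symmetries**:
`(μ^{⊗n}).map (slotEquiv g π) = μ^{⊗n}` whenever `μ.map g = μ`. [folklore] -/
theorem indepLaw_map_slotEquiv (μ : PMF S) (g : S ≃ S) (π : Equiv.Perm (Fin n))
    (hμ : μ.map g = μ) :
    (indepLaw n fun _ => μ).map (slotEquiv g π) = indepLaw n fun _ => μ := by
  have hμ' : ∀ s, μ (g.symm s) = μ s := fun s => by rw [← pmf_map_equiv_apply μ g s, hμ]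
  refine indepLaw_eq_of_apply _ _ fun v => ?_
  rw [pmf_map_equiv_apply, indepLaw_apply]
  simp only [slotEquiv_symm_apply, hμ']
  exact Equiv.prod_comp π.symm (fun j => μ (v j))

end GluingRDE

open GluingRDE

/-! ### The law-level gluing map -/

/-- **The gluing RDE map (Langlands' `Θ_𝔛`, Aldous–Bandyopadhyay's `T`) of a gluing rule with
innovations.** For a rule `glue : (Fin n → S) → Ξ → S` (glue `n` sub-square states, deciding the
ambiguous spots by the innovation `ξ`) and an innovation law `θ : PMF Ξ`, the self-map of the laws
on `S`
`Ψ μ := law of glue (X₀, …, X_{n-1}) ξ`, where `X₀, …, X_{n-1}` are i.i.d. of law `μ` and `ξ ∼ θ` is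
independent of them — the map `T(μ) = dist g(ξ; X₁, …, X_n)` induced by the recursive
distributional equation `X =ᵈ g(ξ; X₁, …, X_n)` (Aldous–Bandyopadhyay 2005, §2.1), which for a
rule ignoring `ξ` and `n = 4` is the map `Θ_𝔛 : 𝔛 → 𝔛` on the simplex `𝔛` of measures on the state
space `A` of a finite model induced by `Θ_A : A × A × A × A → A` (LPSA 1994, §2.3; `langlandsTheta`,
`gluingRDE_const`). Route `CardyGluingRDE`: `Ψ_k = gluingRDE (PlanarCoinGlue k) (uniform coins)`.
[cite: LanglandsPouliotSaintaubin1994, §2.3] -/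
def gluingRDE (glue : (Fin n → S) → Ξ → S) (θ : PMF Ξ) (μ : PMF S) : PMF S :=
  (indepLaw n fun _ => μ).bind fun x => θ.map (glue x)

/-- Unfolding: `Ψ μ = μ^{⊗n} >>= (x ↦ θ.map (glue x))`. [folklore] -/
theorem gluingRDE_def (glue : (Fin n → S) → Ξ → S) (θ : PMF Ξ) (μ : PMF S) :
    gluingRDE glue θ μ = (indepLaw n fun _ => μ).bind fun x => θ.map (glue x) := rfl

/-- **Mass formula** (general form): `(Ψ μ)(s) = ∑' x, (∏ᵢ μ (x i)) · ∑' ξ, [s = glue x ξ] θ ξ`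
(independence of `X₀, …, X_{n-1}, ξ`). [folklore] -/
theorem gluingRDE_apply [DecidableEq S] (glue : (Fin n → S) → Ξ → S) (θ : PMF Ξ) (μ : PMF S)
    (s : S) :
    gluingRDE glue θ μ s =
      ∑' x : Fin n → S, (∏ i, μ (x i)) * ∑' ξ, if s = glue x ξ then θ ξ else 0 := by
  simp only [gluingRDE, PMF.bind_apply, PMF.map_apply, indepLaw_apply]
  refine tsum_congr fun x => ?_
  congr 1
  exact tsum_congr fun ξ => by congr

/-- **Mass formula on finite types — `Ψ` is a polynomial map of degree `n` on the simplex**: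
`(Ψ μ)(s) = ∑_{x : Fin n → S} ∑_ξ θ(ξ) · (∏ᵢ μ(xᵢ)) · [glue x ξ = s]`. [folklore] -/
theorem gluingRDE_apply_eq_sum [Fintype S] [DecidableEq S] [Fintype Ξ]
    (glue : (Fin n → S) → Ξ → S) (θ : PMF Ξ) (μ : PMF S) (s : S) :
    gluingRDE glue θ μ s =
      ∑ x : Fin n → S, ∑ ξ, θ ξ * (∏ i, μ (x i)) * (if glue x ξ = s then 1 else 0) := by
  rw [gluingRDE_apply, tsum_fintype]
  refine Finset.sum_congr rfl fun x _ => ?_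
  rw [tsum_fintype, Finset.mul_sum]
  refine Finset.sum_congr rfl fun ξ _ => ?_
  by_cases h : glue x ξ = s
  · rw [if_pos h, if_pos h.symm, mul_one, mul_comm]
  · rw [if_neg h, if_neg (Ne.symm h), mul_zero, mul_zero]

/-- **Real coordinates**: `(Ψ μ)(s) = ∑_x ∑_ξ θ(ξ) (∏ᵢ μ(xᵢ)) [glue x ξ = s]` as real numbers — the
coordinates of `Ψ μ` are polynomials of degree `n` in the coordinates `(μ t)_{t ∈ S}` of `μ`.
[folklore] -/
theorem toReal_gluingRDE_apply [Fintype S] [DecidableEq S] [Fintype Ξ]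
    (glue : (Fin n → S) → Ξ → S) (θ : PMF Ξ) (μ : PMF S) (s : S) :
    (gluingRDE glue θ μ s).toReal =
      ∑ x : Fin n → S, ∑ ξ, (θ ξ).toReal * (∏ i, (μ (x i)).toReal) *
        (if glue x ξ = s then 1 else 0) := by
  have hterm : ∀ (x : Fin n → S) (ξ : Ξ),
      θ ξ * (∏ i, μ (x i)) * (if glue x ξ = s then 1 else 0) ≠ ∞ := fun x ξ =>
    ENNReal.mul_ne_top (ENNReal.mul_ne_top (θ.apply_ne_top ξ)
      (ENNReal.prod_ne_top fun i _ => μ.apply_ne_top (x i))) (by split_ifs <;> simp)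
  rw [gluingRDE_apply_eq_sum,
    ENNReal.toReal_sum fun x _ => ENNReal.sum_ne_top.2 fun ξ _ => hterm x ξ]
  refine Finset.sum_congr rfl fun x _ => ?_
  rw [ENNReal.toReal_sum fun ξ _ => hterm x ξ]
  refine Finset.sum_congr rfl fun ξ _ => ?_
  rw [ENNReal.toReal_mul, ENNReal.toReal_mul, ENNReal.toReal_prod]
  split_ifs <;> simp

/-- **Uniform coin strings**: with innovations the uniform law on `C → Bool` (`#C` independent fair
coins), `(Ψ μ)(s) = ∑_x ∑_ξ 2^{-#C} (∏ᵢ μ(xᵢ)) [glue x ξ = s]` — the form requested by route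
`CardyGluingRDE` for its coin-resolved planar gluing (`card (C → Bool) = 2^{#C}`). [folklore] -/
theorem gluingRDE_uniformCoins_apply [Fintype S] [DecidableEq S] {C : Type*} [Fintype C]
    [DecidableEq C] (glue : (Fin n → S) → (C → Bool) → S) (μ : PMF S) (s : S) :
    gluingRDE glue (PMF.uniformOfFintype (C → Bool)) μ s =
      ∑ x : Fin n → S, ∑ ξ : C → Bool, (2⁻¹ : ℝ≥0∞) ^ Fintype.card C * (∏ i, μ (x i)) *
        (if glue x ξ = s then 1 else 0) := by
  rw [gluingRDE_apply_eq_sum]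
  simp only [PMF.uniformOfFintype_apply, Fintype.card_fun, Fintype.card_bool, Nat.cast_pow,
    Nat.cast_ofNat, ENNReal.inv_pow]

/-! ### The raw (coin-free) Langlands map -/

/-- **Langlands' map `Θ_𝔛` of a deterministic finite model**: for a rule `Θ : (Fin n → S) → S`
(LPSA94: `Θ_A : A × A × A × A → A`, `n = 4`), the induced self-map of the simplex of laws,
`Θ_𝔛 μ := law of Θ (X₀, …, X_{n-1})`, `Xᵢ` i.i.d. `μ`, i.e. the push-forward `(μ^{⊗n}).map Θ`.
[cite: LanglandsPouliotSaintaubin1994, §2.3] -/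
def langlandsTheta (Θ : (Fin n → S) → S) (μ : PMF S) : PMF S :=
  (indepLaw n fun _ => μ).map Θ

/-- Mass formula: `(Θ_𝔛 μ)(s) = ∑' x, [s = Θ x] ∏ᵢ μ (x i)` (push-forward of the product law).
[folklore] -/
theorem langlandsTheta_apply [DecidableEq S] (Θ : (Fin n → S) → S) (μ : PMF S) (s : S) :
    langlandsTheta Θ μ s = ∑' x : Fin n → S, if s = Θ x then ∏ i, μ (x i) else 0 := by
  simp only [langlandsTheta, PMF.map_apply, indepLaw_apply]

/-- **A rule that ignores its innovation induces the raw map**: `gluingRDE (x ξ ↦ Θ x) θ = Θ_𝔛`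
for every innovation law `θ` (LPSA94's `Θ_𝔛` is the special case of `gluingRDE`). [folklore] -/
theorem gluingRDE_const (Θ : (Fin n → S) → S) (θ : PMF Ξ) (μ : PMF S) :
    gluingRDE (fun x (_ : Ξ) => Θ x) θ μ = langlandsTheta Θ μ := by
  rw [gluingRDE, langlandsTheta, PMF.map]
  refine congrArg _ (funext fun x => ?_)
  exact PMF.map_const θ (Θ x)

/-- **The coin-resolved map is the mixture of the raw maps**: `Ψ μ = θ >>= (ξ ↦ Θ_𝔛[glue (·) ξ] μ)`
— average over the innovation `ξ` of Langlands' maps of the deterministic rules `glue (·) ξ`.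
[folklore] -/
theorem gluingRDE_eq_bind_langlandsTheta (glue : (Fin n → S) → Ξ → S) (θ : PMF Ξ) (μ : PMF S) :
    gluingRDE glue θ μ = θ.bind fun ξ => langlandsTheta (fun x => glue x ξ) μ := by
  rw [gluingRDE]
  simp only [PMF.map, Function.comp_def, langlandsTheta]
  exact PMF.bind_comm _ _ _

/-! ### Symmetric sectors and equivariant rules -/

/-- **The symmetric sector** of a family of symmetries `γ g : S ≃ S` (`g` ranging over any index
type, e.g. a group acting on `S`): the laws on `S` invariant under every `γ g`,
`{μ | ∀ g, μ.map (γ g) = μ}`. Route `CardyGluingRDE`: `γ` = the `D₄` action together with the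
duality involution of `BoxArcState k`. [folklore] -/
def symmetricSector {G : Type*} (γ : G → S ≃ S) : Set (PMF S) :=
  {μ | ∀ g, μ.map (γ g) = μ}

/-- Membership in the symmetric sector, by definition. [folklore] -/
theorem mem_symmetricSector_iff {G : Type*} (γ : G → S ≃ S) (μ : PMF S) :
    μ ∈ symmetricSector γ ↔ ∀ g, μ.map (γ g) = μ := Iff.rfl

/-- Membership in the symmetric sector, pointwise: `μ (γ g s) = μ s` for all `g`, `s`. [folklore] -/
theorem mem_symmetricSector_iff_apply {G : Type*} (γ : G → S ≃ S) (μ : PMF S) :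
    μ ∈ symmetricSector γ ↔ ∀ g s, μ (γ g s) = μ s := by
  refine forall_congr' fun g => ?_
  rw [PMF.ext_iff]
  simp only [pmf_map_equiv_apply]
  constructor
  · intro h s
    simpa using (h (γ g s)).symm
  · intro h s
    simpa using (h ((γ g).symm s)).symm

/-- **Equivariance of a gluing rule under a symmetry `g` of the states**: there are a permutation
`π` of the `n` slots and a relabelling `e` of the innovations preserving their law `θ` such that
gluing the transformed inputs with the relabelled innovation gives the transformed output,
`glue (i ↦ g (x (π i))) (e ξ) = g (glue x ξ)`. (Route `CardyGluingRDE`: a rotation/reflection of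
the square permutes the four sub-squares and the coin positions; duality swaps primal/dual and
negates the coins.) [folklore] -/
def IsGlueSymmetry (glue : (Fin n → S) → Ξ → S) (θ : PMF Ξ) (g : S ≃ S) : Prop :=
  ∃ (π : Equiv.Perm (Fin n)) (e : Ξ ≃ Ξ), θ.map e = θ ∧
    ∀ (x : Fin n → S) (ξ : Ξ), glue (fun i => g (x (π i))) (e ξ) = g (glue x ξ)

/-- For UNIFORM innovations on a finite type every relabelling preserves the law, so equivariance
reduces to the combinatorial identity `glue (i ↦ g (x (π i))) (e ξ) = g (glue x ξ)`. [folklore] -/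
theorem IsGlueSymmetry.of_uniform [Fintype Ξ] [Nonempty Ξ] {glue : (Fin n → S) → Ξ → S}
    {g : S ≃ S} (π : Equiv.Perm (Fin n)) (e : Ξ ≃ Ξ)
    (h : ∀ (x : Fin n → S) (ξ : Ξ), glue (fun i => g (x (π i))) (e ξ) = g (glue x ξ)) :
    IsGlueSymmetry glue (PMF.uniformOfFintype Ξ) g :=
  ⟨π, e, uniformOfFintype_map_equiv_self e, h⟩

/-- A deterministic rule (innovation ignored) is equivariant as soon as
`Θ (i ↦ g (x (π i))) = g (Θ x)` for some slot permutation `π`. [folklore] -/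
theorem IsGlueSymmetry.of_const {Θ : (Fin n → S) → S} (θ : PMF Ξ) {g : S ≃ S}
    (π : Equiv.Perm (Fin n)) (h : ∀ x : Fin n → S, Θ (fun i => g (x (π i))) = g (Θ x)) :
    IsGlueSymmetry (fun x (_ : Ξ) => Θ x) θ g :=
  ⟨π, Equiv.refl Ξ, by simp [PMF.map_id], fun x _ => h x⟩

/-- **Equivariant rules preserve invariant laws**: if `glue` is `g`-equivariant (`IsGlueSymmetry`)
and `μ` is `g`-invariant, then so is `Ψ μ`: `(Ψ μ).map g = Ψ μ`. Proof: `(Ψ μ).map g` is the law of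
`g (glue X ξ) = glue (slotEquiv g π X) (e ξ)`, and `(slotEquiv g π X, e ξ)` has the same law
`μ^{⊗n} ⊗ θ` as `(X, ξ)`. [folklore] -/
theorem gluingRDE_map_equiv {glue : (Fin n → S) → Ξ → S} {θ : PMF Ξ} {g : S ≃ S}
    (hg : IsGlueSymmetry glue θ g) {μ : PMF S} (hμ : μ.map g = μ) :
    (gluingRDE glue θ μ).map g = gluingRDE glue θ μ := by
  obtain ⟨π, e, he, hglue⟩ := hg
  have key : ∀ x : Fin n → S, (θ.map (glue x)).map g = θ.map (glue (slotEquiv g π x)) := by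
    intro x
    have hfun : (g : S → S) ∘ glue x = glue (slotEquiv g π x) ∘ e :=
      funext fun ξ => (hglue x ξ).symm
    rw [PMF.map_comp, hfun, ← PMF.map_comp, he]
  rw [gluingRDE, PMF.map_bind]
  simp_rw [key]
  conv_rhs => rw [← indepLaw_map_slotEquiv μ g π hμ, PMF.bind_map]
  rfl

/-- **`Ψ` maps the symmetric sector to itself** when every symmetry of the family is respected by
the rule (the `D₄ ×` duality sector of route `CardyGluingRDE`). [folklore] -/
theorem mapsTo_gluingRDE_symmetricSector {G : Type*} {γ : G → S ≃ S}
    {glue : (Fin n → S) → Ξ → S} {θ : PMF Ξ} (hγ : ∀ g, IsGlueSymmetry glue θ (γ g)) :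
    Set.MapsTo (gluingRDE glue θ) (symmetricSector γ) (symmetricSector γ) :=
  fun _ hμ g => gluingRDE_map_equiv (hγ g) (hμ g)

/-- The iterates `Ψ^[m]` map the symmetric sector to itself. [folklore] -/
theorem iterate_gluingRDE_mem_symmetricSector {G : Type*} {γ : G → S ≃ S}
    {glue : (Fin n → S) → Ξ → S} {θ : PMF Ξ} (hγ : ∀ g, IsGlueSymmetry glue θ (γ g))
    {μ : PMF S} (hμ : μ ∈ symmetricSector γ) (m : ℕ) :
    (gluingRDE glue θ)^[m] μ ∈ symmetricSector γ :=
  (mapsTo_gluingRDE_symmetricSector hγ).iterate m hμ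

/-! ### The trivial total-variation Lipschitz bound -/

/-- **`Δ(Ψ μ, Ψ ν) ≤ n · Δ(μ, ν)`**: the gluing map is `n`-Lipschitz for the total-variation
distance `PMF.tvDist` (the same kernel `x ↦ θ.map (glue x)` applied to `μ^{⊗n}` and `ν^{⊗n}`
contracts `Δ`, and `Δ(μ^{⊗n}, ν^{⊗n}) ≤ n Δ(μ, ν)` by the hybrid argument). This is the "volume
factor" `n` (`= 2²` for the `2 × 2` gluing) that any contraction statement must beat. [folklore] -/
theorem tvDist_gluingRDE_le (glue : (Fin n → S) → Ξ → S) (θ : PMF Ξ) (μ ν : PMF S) :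
    (gluingRDE glue θ μ).tvDist (gluingRDE glue θ ν) ≤ n * μ.tvDist ν := by
  refine (PMF.tvDist_bind_left_le _ _ _).trans ((tvDist_indepLaw_le n _ _).trans ?_)
  simp

/-- Iterated bound: `Δ(Ψ^[m] μ, Ψ^[m] ν) ≤ n^m · Δ(μ, ν)`. [folklore] -/
theorem tvDist_iterate_gluingRDE_le (glue : (Fin n → S) → Ξ → S) (θ : PMF Ξ) (μ ν : PMF S) :
    ∀ m : ℕ, ((gluingRDE glue θ)^[m] μ).tvDist ((gluingRDE glue θ)^[m] ν) ≤
      (n : ℝ) ^ m * μ.tvDist ν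
  | 0 => by simp
  | m + 1 => by
    rw [Function.iterate_succ_apply', Function.iterate_succ_apply', pow_succ, mul_comm (_ ^ m),
      mul_assoc]
    exact (tvDist_gluingRDE_le glue θ _ _).trans
      (mul_le_mul_of_nonneg_left (tvDist_iterate_gluingRDE_le glue θ μ ν m) n.cast_nonneg)

/-- `Ψ` is uniformly continuous for `Δ`: `Δ(μ, ν) ≤ ε / n` forces `Δ(Ψ μ, Ψ ν) ≤ ε` (`n ≥ 1`).
[folklore] -/
theorem tvDist_gluingRDE_le_of_le (glue : (Fin n → S) → Ξ → S) (θ : PMF Ξ) {μ ν : PMF S} {ε : ℝ}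
    (hn : 1 ≤ n) (h : μ.tvDist ν ≤ ε / n) :
    (gluingRDE glue θ μ).tvDist (gluingRDE glue θ ν) ≤ ε := by
  have hn' : (0 : ℝ) < n := by exact_mod_cast hn
  refine (tvDist_gluingRDE_le glue θ μ ν).trans ?_
  calc (n : ℝ) * μ.tvDist ν ≤ n * (ε / n) := mul_le_mul_of_nonneg_left h hn'.le
    _ = ε := mul_div_cancel₀ ε hn'.ne'

/-! ### Fixed points -/

/-- **Fixed points of `Ψ` are the solutions of the RDE** `μ = T(μ)`, i.e. (on finite types) of
the polynomial system `μ(s) = ∑_x ∑_ξ θ(ξ) (∏ᵢ μ(xᵢ)) [glue x ξ = s]` for all `s` — LPSA94's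
"question of finding fixed points of `Θ_𝔛`". [cite: LanglandsPouliotSaintaubin1994, §2.3] -/
theorem isFixedPt_gluingRDE_iff [Fintype S] [DecidableEq S] [Fintype Ξ]
    (glue : (Fin n → S) → Ξ → S) (θ : PMF Ξ) (μ : PMF S) :
    Function.IsFixedPt (gluingRDE glue θ) μ ↔
      ∀ s, μ s = ∑ x : Fin n → S, ∑ ξ, θ ξ * (∏ i, μ (x i)) * (if glue x ξ = s then 1 else 0) := by
  rw [Function.IsFixedPt, PMF.ext_iff]
  refine forall_congr' fun s => ?_
  rw [gluingRDE_apply_eq_sum, eq_comm]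

/-- A fixed point in the symmetric sector stays one for every iterate, and a fixed point is a fixed
point of all iterates (Mathlib `Function.IsFixedPt.iterate`). [folklore] -/
theorem isFixedPt_iterate_gluingRDE {glue : (Fin n → S) → Ξ → S} {θ : PMF Ξ} {μ : PMF S}
    (h : Function.IsFixedPt (gluingRDE glue θ) μ) (m : ℕ) :
    Function.IsFixedPt ((gluingRDE glue θ)^[m]) μ :=
  h.iterate m

end Literature.Probability.Percolation

end
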